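import Summits.HodgeConjecture.HodgeConjecture.Theorems.F0P3cStCharTSCartanFields      -- ★ p851300 (LH6-p01 (g4)) S9a: `centralizer_eq_of_mem_centralizer`, «ELL-CARTAN-AVOIDS-Ω», `not_isCompact_cmTorus`; brings ★ EllField ∕ HyperbolicSet ∕ TorusDefs
import Summits.HodgeConjecture.HodgeConjecture.Theorems.F0P3cStCharTSHyperbolicCore     -- ★ (F0P3a-p05 (g19)) (H3): `mem_hyperbolicSet_of_one_lt_v_trace` (`Ω° = {|tr γ|_w > 1} ⊆ Ω`)
import Literature.NumberTheory.Rogawski1990.TypeThreeCubicTorusNonsplit               -- ★ p851001 (this lineage, g22): `isRegularElt_iff_separable_localNonsplitEquiv` (one-place model; brings ★ `localNonsplitEquiv_apply_apply`)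
import Literature.LinearAlgebra.Matrix.NonderogatoryCommutant                         -- ★ `exists_eq_aeval_of_commute_of_minpoly_eq_charpoly` (the commutant of a nonderogatory matrix is `K[A]`)
import Literature.LinearAlgebra.Matrix.NonderogatoryCommutantBaseChange               -- ★ `minpoly_eq_charpoly_of_charpoly_separable`
import Summits.HodgeConjecture.HodgeConjecture.Theorems.F0P3cStCharTSTracePairing      -- (this seat) «TRACE-PAIRING★»: `exists_linearEquiv_tracePairing` (non-degenerate trace pairing of `K[A]`, over ★ p851310 `exists_eigencharacters`)
import Literature.NumberTheory.Automorphic.AdicCompletionCompact                      -- ★ `properSpace_adicCompletion` (`L_w` is proper: closed balls are compact)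
import HarnessLib

/-!
# F0 · P3c · line LH6 «StCharTS» — «ELL-CARTAN-COMPACT★»: a REGULAR element of `U(Φ₃)(L⁺_v)` OUTSIDE the hyperbolic set `Ω` has a COMPACT centraliser
# (the converse of ★ S9a «ELL-CARTAN-AVOIDS-Ω»; so `G^e := G^r ∖ Ω` IS print's set of regular elements with compact centraliser, and every NON-compact Cartan
# subgroup `Z(γ₀)` is `Ad(G)`-conjugate to the split torus `M`) [Rogawski1990, §12.5 p. 184; §3.6 pp. 28–31]

Cell `pub/hodgecm-mathlib`, crux H413 = `stmt-HodgeConjecture-24833` (lane `--supports … --as helper`), route HCCMUnconditional; seat F0P3a-p03 (g23) (census-first default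
«ELL-CARTAN-COMPACT★» announced on the datum road 2026-09-02T12:24Z; map owner LH6-p01 (g4)).  THEOREMS ONLY (no definition ∕ instance ∕ notation ∕ named fact ∕ `sorry`);
★-only imports + Mathlib.

WHAT.  `G = Gqs L v = U(Φ₃)(L⁺_v)` at a NON-SPLIT finite place `v` (place `w ∣ v` of the CM field `L`), `Ω = hyperbolicSet L v` = the conjugates of the regular elements of
the split torus `M` (★ `F0P3cStCharTSTorusDefs`), `Z(γ) = Subgroup.centralizer {γ}`.
* §1 `not_mem_hyperbolicSet_of_mem_centralizer` — if `γ₀` is regular and `γ₀ ∉ Ω`, then NO element of `Z(γ₀)` lies in `Ω` (a `t = x m x⁻¹ ∈ Z(γ₀) ∩ Ω` is regular with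
  `Z(t) = Z(γ₀)` ★ and `Z(m) = M` ★, so `x⁻¹ γ₀ x ∈ M` is a regular element of `M` conjugate to `γ₀`, i.e. `γ₀ ∈ Ω`); hence, by ★ (H3) `Ω° ⊆ Ω`, **`|tr t|_w ≤ 1` for every
  `t ∈ Z(γ₀)`** (`v_trace_le_one_of_mem_centralizer`).
* (generic input, own file ★ `F0P3cStCharTSTracePairing`) for `A ∈ M_N(K)` with separable characteristic polynomial the trace pairing of `K[A]` is
  non-degenerate in the power basis: `c ↦ (tr((Σ_i c_i A^i)·A^j))_j` is a linear automorphism of `K^N` (`exists_linearEquiv_tracePairing`).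
* §2 (the one-place model `U(σ_w, Φ₃)(L_w) ≤ GL₃(L_w)`, `L_w` proper) **`isCompact_centralizer_of_forall_v_trace_le_one`** — if `A` is unitary with separable characteristic
  polynomial and `|tr u|_w ≤ 1` for every unitary `u` commuting with `A`, then `Z_{U}(A)` is COMPACT: every such `u` is `Σ_{i<3} c_i A^i` (★ nonderogatory commutant), its
  coordinates `c` lie in the preimage of the closed unit box under the INVERTIBLE linear map `c ↦ (tr((Σ c_i A^i)·A^j))_j` (because `u·A^j ∈ Z_U(A)` too), a compact
  subset of `L_w³`; `Z_U(A)` is the continuous image of the (closed, hence compact) unitary part of that set.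
* §3 (transport to the organ's carrier along ★ `localNonsplitEquiv`) **`isCompact_centralizer_of_not_mem_hyperbolicSet`** — `γ₀` regular, `γ₀ ∉ Ω` ⇒ `Z(γ₀)` compact;
  with ★ S9a's converse: **`isCompact_centralizer_iff_not_mem_hyperbolicSet`**; **`mem_ellG_iff_isCompact_centralizer`** — at any datum with `hE : ellG = G^r ∖ Ω` (COMPAT), `γ ∈ 𝔇.ellG ↔
  IsRegularElt γ ∧ IsCompact Z(γ)` (print's definition of `G^e`, p. 184: PRINT-EXACTNESS of the organ's `ellG` field); **`exists_centralizer_eq_conj_cmTorus_of_not_isCompact`** — a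
  regular `γ₀` with NON-compact centraliser has `Z(γ₀) = x M x⁻¹` («the only non-elliptic Cartan subgroup up to conjugacy is `M`», §3.6: so an abstract finite set of
  representatives of the conjugacy classes of Cartan subgroups may be replaced by `insert M (the compact ones)` in the datum's `cartanAll`).
HONEST LABEL: HC_CM is proved only modulo the 7 printed citations (2 remaining named inputs: hLiu418 = `stmt-HodgeConjecture-24832`, h413 = `stmt-HodgeConjecture-24833`)
until rung 0 closes; this file closes no organ (count-neutral constructor-side asset of the (S-𝔇) datum road).

## References
* [Rogawski1990] J. D. Rogawski, *Automorphic Representations of Unitary Groups in Three Variables*, Ann. of Math. Stud. 123 (1990): §3.1 p. 19 (regular elements); §3.6 pp. 28–31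
  (the Cartan subgroups of `U(3)`: type (0) `M ≅ E^× × E¹` non-compact, types (1)–(3) compact modulo the centre); §12.5 p. 182 (`G^r ∩ Ad(G)M`), p. 184 (`G^e`, the regular
  elliptic set; the elliptic Cartan subgroups are compact modulo the centre).
* [PlatonovRapinchuk1994] V. Platonov, A. Rapinchuk, *Algebraic Groups and Number Theory* (1994), §3.3 (anisotropic tori over local fields are compact), §6.4 Prop. 6.15.
* [HornJohnson2013] R. A. Horn, C. R. Johnson, *Matrix Analysis*, 2nd ed. (2013), Thm. 3.2.4.2 (the commutant of a nonderogatory matrix is `K[A]`).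
-/

set_option autoImplicit false
-- the mandated namespace has the single-problem summit's repeated segment (`HodgeConjecture.HodgeConjecture`)
set_option linter.dupNamespace false

noncomputable section

open NumberField IsDedekindDomain Filter Topology Polynomial
open scoped Matrix MatrixGroups
open Literature.NumberTheory.Rogawski1990 Literature.NumberTheory.Automorphic Literature.NumberTheory.Automorphic.UnitaryGroup
open Literature.NumberTheory.GaloisRepresentations
open Literature.NumberTheory.Rogawski1990.Ch12Sec5
open Summit.HodgeConjecture.HodgeConjecture.Cruxes.H413.F0P3cStCharTSTorusDefs
open Summit.HodgeConjecture.HodgeConjecture.Cruxes.H413.F0P3cStCharTSHyperbolicSet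
open Summit.HodgeConjecture.HodgeConjecture.Cruxes.H413.F0P3cStCharTSHyperbolicCore
open Summit.HodgeConjecture.HodgeConjecture.Cruxes.H413.F0P3cStCharTSCartanFields
open Literature.NumberTheory.Rogawski1990.TypeThreeTorus
open Summit.HodgeConjecture.HodgeConjecture.Cruxes.H413.F0P3cStCharTSTracePairing

namespace Summit.HodgeConjecture.HodgeConjecture.Cruxes.H413.F0P3cStCharTSEllCartanCompact

/-! ## §1 On the organ's carrier: the centraliser of a regular `γ₀ ∉ Ω` avoids `Ω`, hence has `w`-integral traces -/

section Carrier

variable (L : Type) [Field L] [NumberField L] [IsCMField L] (v : HeightOneSpectrum (𝓞 ↥(maximalRealSubfield L)))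

set_option maxHeartbeats 800000 in  -- statement-level `whnf` on the CM carriers (`Gqs L v` vs the subgroup type)
/-- **No element of the centraliser of a regular `γ₀ ∉ Ω` lies in `Ω`.**  If `t = x m x⁻¹ ∈ Z(γ₀)` with `m ∈ M` regular, then `t` is regular, `Z(t) = Z(γ₀)` (★
`centralizer_eq_of_mem_centralizer`) contains `γ₀`, so `x⁻¹ γ₀ x` commutes with `m`, i.e. lies in `Z(m) = M` (★ `centralizer_eq_cmTorus_of_isRegularElt`): a regular element of `M`
conjugate to `γ₀` — `γ₀ ∈ Ω`, contradiction. [cite: Rogawski1990, §12.5 pp. 182, 184; §3.6 p. 28] -/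
theorem not_mem_hyperbolicSet_of_mem_centralizer
    {γ₀ : ↥(unitaryGroupOfForm (conjLocal L (IsCMField.complexConj L) v) (cmLocalForm L 3 v))}
    (hγ₀ : IsRegularElt (γ₀ : GL (Fin 3) (LocalRing L v))) (hγ₀Ω : (γ₀ : Gqs L v) ∉ hyperbolicSet L v)
    {t : ↥(unitaryGroupOfForm (conjLocal L (IsCMField.complexConj L) v) (cmLocalForm L 3 v))}
    (ht : t ∈ Subgroup.centralizer ({γ₀} : Set ↥(unitaryGroupOfForm (conjLocal L (IsCMField.complexConj L) v) (cmLocalForm L 3 v)))) :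
    (t : Gqs L v) ∉ hyperbolicSet L v := by
  intro htΩ
  have htreg : IsRegularElt (t : GL (Fin 3) (LocalRing L v)) := isRegularElt_of_mem_hyperbolicSet L v htΩ
  obtain ⟨m, hmreg, hconj⟩ := htΩ
  obtain ⟨x, hx⟩ := isConj_iff.1 hconj
  -- read the conjugator in the subtype group `U(Φ₃)(L⁺_v)` (the carrier of `Gqs L v`, definitionally)
  let x' : ↥(unitaryGroupOfForm (conjLocal L (IsCMField.complexConj L) v) (cmLocalForm L 3 v)) := x
  have hx' : x' * (m : ↥(unitaryGroupOfForm (conjLocal L (IsCMField.complexConj L) v) (cmLocalForm L 3 v))) * x'⁻¹ = t := hx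
  have hZm := F0P3cStCharTSWeylHypCM.centralizer_eq_cmTorus_of_isRegularElt L v m.2 hmreg
  have hZt := centralizer_eq_of_mem_centralizer L v hγ₀ ht htreg
  -- `γ₀ ∈ Z(t)`, so `x⁻¹ γ₀ x ∈ Z(m) = M`
  have hγ₀t : γ₀ ∈ Subgroup.centralizer ({t} : Set ↥(unitaryGroupOfForm (conjLocal L (IsCMField.complexConj L) v) (cmLocalForm L 3 v))) := by
    rw [hZt, Subgroup.mem_centralizer_singleton_iff]
  rw [Subgroup.mem_centralizer_singleton_iff, ← hx'] at hγ₀t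
  set m' : ↥(unitaryGroupOfForm (conjLocal L (IsCMField.complexConj L) v) (cmLocalForm L 3 v)) := x'⁻¹ * γ₀ * x' with hm'
  have hm'M : m' ∈ (cmBorelTriple L 3 v).M := by
    rw [← hZm, Subgroup.mem_centralizer_singleton_iff, hm']
    have h1 : x'⁻¹ * γ₀ * x' * ↑m = x'⁻¹ * (γ₀ * (x' * ↑m * x'⁻¹)) * x' := by group
    have h2 : ↑m * (x'⁻¹ * γ₀ * x') = x'⁻¹ * ((x' * ↑m * x'⁻¹) * γ₀) * x' := by group
    rw [h1, h2, hγ₀t]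
  have hm'reg : IsRegularElt ((m' : ↥(unitaryGroupOfForm (conjLocal L (IsCMField.complexConj L) v) (cmLocalForm L 3 v))) : GL (Fin 3) (LocalRing L v)) := by
    have h := (isRegularElt_conj_iff ((x' : GL (Fin 3) (LocalRing L v))⁻¹) (γ₀ : GL (Fin 3) (LocalRing L v))).2 hγ₀
    rw [inv_inv] at h
    rw [hm', Subgroup.coe_mul, Subgroup.coe_mul, Subgroup.coe_inv]
    exact h
  have hfin : x' * m' * x'⁻¹ = γ₀ := by rw [hm']; group
  exact hγ₀Ω ⟨⟨m', hm'M⟩, hm'reg, isConj_iff.2 ⟨x, hfin⟩⟩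

set_option maxHeartbeats 800000 in  -- statement-level `whnf` on the CM carriers
/-- **`|tr t|_w ≤ 1` on the centraliser of a regular `γ₀ ∉ Ω`** (`v` non-split, `w ∣ v`): otherwise `t ∈ Ω° ⊆ Ω` (★ (H3) `mem_hyperbolicSet_of_one_lt_v_trace`), against §1.
[cite: Rogawski1990, §12.5 p. 182; §12.7 Lemma 12.7.1 (proof) p. 191] -/
theorem v_trace_le_one_of_mem_centralizer (hns : ∀ w : PlacesOver L v, IsCMField.complexConj L • w.1 = w.1) (w : PlacesOver L v)
    {γ₀ : ↥(unitaryGroupOfForm (conjLocal L (IsCMField.complexConj L) v) (cmLocalForm L 3 v))}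
    (hγ₀ : IsRegularElt (γ₀ : GL (Fin 3) (LocalRing L v))) (hγ₀Ω : (γ₀ : Gqs L v) ∉ hyperbolicSet L v)
    {t : ↥(unitaryGroupOfForm (conjLocal L (IsCMField.complexConj L) v) (cmLocalForm L 3 v))}
    (ht : t ∈ Subgroup.centralizer ({γ₀} : Set ↥(unitaryGroupOfForm (conjLocal L (IsCMField.complexConj L) v) (cmLocalForm L 3 v)))) :
    Valued.v ((Pi.evalRingHom (fun w' : PlacesOver L v => w'.1.adicCompletion L) w)
      (Matrix.trace ((t : Gqs L v).val.val : Matrix (Fin 3) (Fin 3) (LocalRing L v)))) ≤ 1 :=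
  not_lt.1 fun h => not_mem_hyperbolicSet_of_mem_centralizer L v hγ₀ hγ₀Ω ht (mem_hyperbolicSet_of_one_lt_v_trace L v hns w (t : Gqs L v) h).1

end Carrier



/-! ## §2 The one-place model `U(σ_w, Φ₃)(L_w) ≤ GL₃(L_w)`: a unitary `A` with separable characteristic polynomial and `w`-integral traces on its centraliser has a
COMPACT centraliser -/

section OnePlace

variable (L : Type) [Field L] [NumberField L] [IsCMField L] {v : HeightOneSpectrum (𝓞 ↥(maximalRealSubfield L))}
  (w : PlacesOver L v) (hw : IsCMField.complexConj L • w.1 = w.1)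

/-- The centraliser of a point of a Hausdorff topological group is closed. [folklore] -/
private theorem isClosed_centralizer_singleton {G : Type*} [Group G] [TopologicalSpace G] [IsTopologicalGroup G] [T2Space G] (t : G) :
    IsClosed (Subgroup.centralizer ({t} : Set G) : Set G) := by
  have h : (Subgroup.centralizer ({t} : Set G) : Set G) = {g : G | t * g = g * t} := by
    ext g
    simp [Subgroup.mem_centralizer_iff]
  rw [h]
  exact isClosed_eq (continuous_const.mul continuous_id) (continuous_id.mul continuous_const)

omit [IsCMField L] in
/-- `det Φ₃ = −1` is a unit (the one-place form `placeForm Φ₃ w = antidiag(1,1,1)`, ★ `placeForm_qsForm_eq`). [cite: Rogawski1990, §1.9 p. 8] -/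
theorem isUnit_det_placeForm_qsForm : IsUnit (placeForm (qsForm L) w.1).det := by
  rw [placeForm_qsForm_eq L w, Matrix.det_fin_three]
  simp

include hw in
/-- **Compactness of the centraliser in the one-place model from `w`-integral traces.**  Let `A ∈ U(σ_w, Φ₃)(L_w)` have SEPARABLE characteristic polynomial and suppose
`|tr u|_w ≤ 1` for every `u ∈ Z_U(A)`.  Then `Z_U(A)` is compact: every `u ∈ Z_U(A)` is `Σ_{i<3} c_i A^i` (★ `exists_eq_aeval_of_commute_of_minpoly_eq_charpoly`, `q_A = p_A` ★),
and since `u·A^j ∈ Z_U(A)` the coordinate vector `c` lies in the preimage of the compact unit box `𝒪_w³` under the INVERTIBLE (★ TRACE-PAIRING), hence bicontinuous, linear map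
`c ↦ (tr((Σ c_i A^i)·A^j))_j`; `Z_U(A)` is contained in the continuous image of the closed unitary part of that compact set, and is closed.
[cite: Rogawski1990, §3.6 pp. 28–31; §12.5 p. 184] [cite: PlatonovRapinchuk1994, §3.3] -/
theorem isCompact_centralizer_onePlace_of_forall_v_trace_le_one
    (A : ↥(unitaryGroupOfForm (galAdicCompletionMap (L := L) (IsCMField.complexConj L) hw) (placeForm (qsForm L) w.1)))
    (hA : (((A : GL (Fin 3) (w.1.adicCompletion L)) : Matrix (Fin 3) (Fin 3) (w.1.adicCompletion L)).charpoly).Separable)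
    (hbd : ∀ u ∈ Subgroup.centralizer ({A} : Set ↥(unitaryGroupOfForm (galAdicCompletionMap (L := L) (IsCMField.complexConj L) hw) (placeForm (qsForm L) w.1))),
      Valued.v (Matrix.trace ((u : GL (Fin 3) (w.1.adicCompletion L)) : Matrix (Fin 3) (Fin 3) (w.1.adicCompletion L))) ≤ 1) :
    IsCompact ((Subgroup.centralizer ({A} : Set ↥(unitaryGroupOfForm (galAdicCompletionMap (L := L) (IsCMField.complexConj L) hw) (placeForm (qsForm L) w.1)))) :
      Set ↥(unitaryGroupOfForm (galAdicCompletionMap (L := L) (IsCMField.complexConj L) hw) (placeForm (qsForm L) w.1))) := by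
  classical
  -- `L_w` as a non-trivially normed field (same uniformity), so that finite-dimensional linear maps are bicontinuous
  letI : NontriviallyNormedField (w.1.adicCompletion L) := Valued.toNontriviallyNormedField (w.1.adicCompletion L) (WithZero (Multiplicative ℤ))
  haveI := compactSpace_integer_adicCompletion L w.1
  have hσc : Continuous (galAdicCompletionMap (L := L) (IsCMField.complexConj L) hw) := continuous_galAdicCompletionMap L (IsCMField.complexConj L) hw
  obtain ⟨ϖ, hϖ, -⟩ := exists_uniformizer L w hw
  -- the matrix of `A`, the form, and the minimal polynomial
  obtain ⟨Am, hAm⟩ : ∃ Am : Matrix (Fin 3) (Fin 3) (w.1.adicCompletion L), Am = ((A : GL (Fin 3) (w.1.adicCompletion L)) : Matrix (Fin 3) (Fin 3) (w.1.adicCompletion L)) := ⟨_, rfl⟩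
  obtain ⟨J, hJ⟩ : ∃ J : Matrix (Fin 3) (Fin 3) (w.1.adicCompletion L), J = placeForm (qsForm L) w.1 := ⟨_, rfl⟩
  have hJdet : IsUnit J.det := by rw [hJ]; exact isUnit_det_placeForm_qsForm L w
  rw [← hAm] at hA
  have hmin := Literature.LinearAlgebra.Matrix.minpoly_eq_charpoly_of_charpoly_separable Am hA
  -- the trace pairing as a bicontinuous linear automorphism of `L_w³`
  obtain ⟨e, he⟩ := exists_linearEquiv_tracePairing Am hA
  let ec : (Fin 3 → w.1.adicCompletion L) ≃L[w.1.adicCompletion L] (Fin 3 → w.1.adicCompletion L) := e.toContinuousLinearEquiv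
  have hec : ∀ c j, ec c j = Matrix.trace ((∑ i : Fin 3, c i • Am ^ (i : ℕ)) * Am ^ (j : ℕ)) := he
  -- the coordinate map `c ↦ Σ c_i A^i`
  have hPc : Continuous (fun c : Fin 3 → w.1.adicCompletion L => ∑ i : Fin 3, c i • Am ^ (i : ℕ)) :=
    continuous_finsetSum _ fun i _ => (continuous_apply i).smul continuous_const
  -- the compact unit box and its (compact) preimage
  have hBox : IsCompact {x : Fin 3 → w.1.adicCompletion L | ∀ j, Valued.v (x j) ≤ 1} := by
    have h1 : IsCompact {x : w.1.adicCompletion L | Valued.v x ≤ WithZero.exp (0 : ℤ)} := HermitianLattice.isCompact_setOf_v_le_exp_int hϖ 0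
    have heq : {x : Fin 3 → w.1.adicCompletion L | ∀ j, Valued.v (x j) ≤ 1} =
        Set.pi Set.univ (fun _ : Fin 3 => {x : w.1.adicCompletion L | Valued.v x ≤ WithZero.exp (0 : ℤ)}) := by
      ext x
      simp only [Set.mem_setOf_eq, Set.mem_univ_pi, WithZero.exp_zero]
    rw [heq]
    exact isCompact_univ_pi fun _ => h1
  have hC : IsCompact (ec ⁻¹' {x : Fin 3 → w.1.adicCompletion L | ∀ j, Valued.v (x j) ≤ 1}) := by
    rw [← ec.image_symm_eq_preimage]
    exact hBox.image ec.symm.continuous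
  -- the unitary part of the preimage: compact
  have hQc : Continuous (fun c : Fin 3 → w.1.adicCompletion L =>
      ((∑ i : Fin 3, c i • Am ^ (i : ℕ)).map (galAdicCompletionMap (L := L) (IsCMField.complexConj L) hw))ᵀ * J * (∑ i : Fin 3, c i • Am ^ (i : ℕ))) :=
    ((hPc.matrix_map hσc).matrix_transpose.matrix_mul continuous_const).matrix_mul hPc
  obtain ⟨S, hS⟩ : ∃ S : Set (Fin 3 → w.1.adicCompletion L), S = ec ⁻¹' {x : Fin 3 → w.1.adicCompletion L | ∀ j, Valued.v (x j) ≤ 1} ∩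
      {c | ((∑ i : Fin 3, c i • Am ^ (i : ℕ)).map (galAdicCompletionMap (L := L) (IsCMField.complexConj L) hw))ᵀ * J * (∑ i : Fin 3, c i • Am ^ (i : ℕ)) = J} := ⟨_, rfl⟩
  have hSc : IsCompact S := by
    rw [hS]
    exact hC.inter_right (isClosed_eq hQc continuous_const)
  haveI : CompactSpace S := isCompact_iff_compactSpace.1 hSc
  have hmemS : ∀ c : S, ((∑ i : Fin 3, c.1 i • Am ^ (i : ℕ)).map (galAdicCompletionMap (L := L) (IsCMField.complexConj L) hw))ᵀ * J * (∑ i : Fin 3, c.1 i • Am ^ (i : ℕ)) = J :=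
    fun c => by
      have h : (c : Fin 3 → w.1.adicCompletion L) ∈ ec ⁻¹' {x : Fin 3 → w.1.adicCompletion L | ∀ j, Valued.v (x j) ≤ 1} ∩
          {c | ((∑ i : Fin 3, c i • Am ^ (i : ℕ)).map (galAdicCompletionMap (L := L) (IsCMField.complexConj L) hw))ᵀ * J * (∑ i : Fin 3, c i • Am ^ (i : ℕ)) = J} := by
        rw [← hS]; exact c.2
      exact h.2
  -- the unit attached to a point of `S`: inverse `J⁻¹ (σP)ᵀ J`
  have hinvmul : ∀ c : S, J⁻¹ * ((∑ i : Fin 3, c.1 i • Am ^ (i : ℕ)).map (galAdicCompletionMap (L := L) (IsCMField.complexConj L) hw))ᵀ * J *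
      (∑ i : Fin 3, c.1 i • Am ^ (i : ℕ)) = 1 := fun c => by
    rw [Matrix.mul_assoc J⁻¹, Matrix.mul_assoc J⁻¹, hmemS c, Matrix.nonsing_inv_mul _ hJdet]
  have hmulinv : ∀ c : S, (∑ i : Fin 3, c.1 i • Am ^ (i : ℕ)) *
      (J⁻¹ * ((∑ i : Fin 3, c.1 i • Am ^ (i : ℕ)).map (galAdicCompletionMap (L := L) (IsCMField.complexConj L) hw))ᵀ * J) = 1 := fun c =>
    mul_eq_one_comm.1 (hinvmul c)
  have hψc : Continuous (fun c : S => (⟨⟨∑ i : Fin 3, c.1 i • Am ^ (i : ℕ),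
      J⁻¹ * ((∑ i : Fin 3, c.1 i • Am ^ (i : ℕ)).map (galAdicCompletionMap (L := L) (IsCMField.complexConj L) hw))ᵀ * J, hmulinv c, hinvmul c⟩,
      (mem_unitaryGroupOfForm_iff (σ := galAdicCompletionMap (L := L) (IsCMField.complexConj L) hw) (J := placeForm (qsForm L) w.1)).2 (by
        rw [← hJ]; exact hmemS c)⟩ :
      ↥(unitaryGroupOfForm (galAdicCompletionMap (L := L) (IsCMField.complexConj L) hw) (placeForm (qsForm L) w.1)))) := by
    refine (Units.continuous_iff.2 ⟨?_, ?_⟩).subtype_mk _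
    · exact hPc.comp continuous_subtype_val
    · show Continuous fun c : S => J⁻¹ * ((∑ i : Fin 3, c.1 i • Am ^ (i : ℕ)).map (galAdicCompletionMap (L := L) (IsCMField.complexConj L) hw))ᵀ * J
      exact ((continuous_const.matrix_mul ((hPc.comp continuous_subtype_val).matrix_map hσc).matrix_transpose).matrix_mul continuous_const)
  -- `Z_U(A)` lies in the (compact) range
  refine (isCompact_range hψc).of_isClosed_subset (isClosed_centralizer_singleton A) fun u hu => ?_
  have hcomm : Commute Am ((u : GL (Fin 3) (w.1.adicCompletion L)) : Matrix (Fin 3) (Fin 3) (w.1.adicCompletion L)) := by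
    have h := Subgroup.mem_centralizer_singleton_iff.1 hu
    have h' := congrArg (fun g : ↥(unitaryGroupOfForm (galAdicCompletionMap (L := L) (IsCMField.complexConj L) hw) (placeForm (qsForm L) w.1)) =>
      ((g : GL (Fin 3) (w.1.adicCompletion L)) : Matrix (Fin 3) (Fin 3) (w.1.adicCompletion L))) h
    simp only [Subgroup.coe_mul, Units.val_mul] at h'
    rw [← hAm] at h'
    exact h'.symm
  obtain ⟨p, hpdeg, hp⟩ := Literature.LinearAlgebra.Matrix.exists_eq_aeval_of_commute_of_minpoly_eq_charpoly Am _ hmin hcomm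
  have hpn : p.natDegree < 3 := by
    by_cases hp0 : p = 0
    · rw [hp0, natDegree_zero]; norm_num
    · have h3 : p.degree < ((3 : ℕ) : WithBot ℕ) := by simpa [Fintype.card_fin] using hpdeg
      exact (natDegree_lt_iff_degree_lt hp0).2 h3
  set c : Fin 3 → w.1.adicCompletion L := fun i => p.coeff i with hc
  have hPc_eq : ∑ i : Fin 3, c i • Am ^ (i : ℕ) = ((u : GL (Fin 3) (w.1.adicCompletion L)) : Matrix (Fin 3) (Fin 3) (w.1.adicCompletion L)) := by
    rw [hp, aeval_eq_sum_range' hpn, Finset.sum_range (fun i => p.coeff i • Am ^ i)]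
  -- `c ∈ S`
  have hcS : c ∈ S := by
    rw [hS]
    refine ⟨?_, ?_⟩
    · show ec c ∈ {x : Fin 3 → w.1.adicCompletion L | ∀ j, Valued.v (x j) ≤ 1}
      intro j
      rw [hec, hPc_eq]
      have hmem : u * A ^ (j : ℕ) ∈ Subgroup.centralizer ({A} : Set ↥(unitaryGroupOfForm (galAdicCompletionMap (L := L) (IsCMField.complexConj L) hw) (placeForm (qsForm L) w.1))) :=
        Subgroup.mul_mem _ hu (Subgroup.pow_mem _ (Subgroup.mem_centralizer_singleton_iff.2 rfl) _)
      have hval : ((((u * A ^ (j : ℕ) : ↥(unitaryGroupOfForm (galAdicCompletionMap (L := L) (IsCMField.complexConj L) hw) (placeForm (qsForm L) w.1))) :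
          GL (Fin 3) (w.1.adicCompletion L)) : Matrix (Fin 3) (Fin 3) (w.1.adicCompletion L))) =
          ((u : GL (Fin 3) (w.1.adicCompletion L)) : Matrix (Fin 3) (Fin 3) (w.1.adicCompletion L)) * Am ^ (j : ℕ) := by
        rw [Subgroup.coe_mul, Subgroup.coe_pow, Units.val_mul, Units.val_pow_eq_pow_val, hAm]
      have h := hbd _ hmem
      rw [hval] at h
      exact h
    · show ((∑ i : Fin 3, c i • Am ^ (i : ℕ)).map (galAdicCompletionMap (L := L) (IsCMField.complexConj L) hw))ᵀ * J * (∑ i : Fin 3, c i • Am ^ (i : ℕ)) = J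
      rw [hPc_eq, hJ]
      exact (mem_unitaryGroupOfForm_iff (σ := galAdicCompletionMap (L := L) (IsCMField.complexConj L) hw) (J := placeForm (qsForm L) w.1)).1 u.2
  refine ⟨⟨c, hcS⟩, Subtype.ext (Units.ext ?_)⟩
  exact hPc_eq

end OnePlace

/-! ## §3 Transport to the organ's carrier `Gqs L v`: compact centraliser ⟺ `∉ Ω`; `G^e` is print's set; non-compact Cartan subgroups are conjugate to `M` -/

section Transport

variable (L : Type) [Field L] [NumberField L] [IsCMField L] (v : HeightOneSpectrum (𝓞 ↥(maximalRealSubfield L)))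

/-- **«ELL-CARTAN-COMPACT★»: a regular `γ₀ ∈ U(Φ₃)(L⁺_v)` OUTSIDE `Ω` has a COMPACT centraliser** (`v` non-split).  Transport of §2 along the one-place model ★ `localNonsplitEquiv`:
the traces on `Z(e γ₀) = e(Z(γ₀))` are `w`-integral by §1, and `Z(γ₀) ⊆ e⁻¹(Z(e γ₀))` is closed. [cite: Rogawski1990, §12.5 p. 184; §3.6 pp. 28–31] [cite: PlatonovRapinchuk1994, §3.3] -/
theorem isCompact_centralizer_of_not_mem_hyperbolicSet (hns : ∀ w : PlacesOver L v, IsCMField.complexConj L • w.1 = w.1) {γ₀ : Gqs L v}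
    (hreg : IsRegularElt (γ₀.val : GL (Fin 3) (LocalRing L v))) (hγ₀Ω : γ₀ ∉ hyperbolicSet L v) :
    IsCompact ((Subgroup.centralizer ({γ₀} : Set (Gqs L v))) : Set (Gqs L v)) := by
  classical
  obtain ⟨w⟩ := (inferInstance : Nonempty (PlacesOver L v))
  have hw := hns w
  set e := localNonsplitEquiv (IsCMField.complexConj L) (qsForm L) (IsCMField.complexConj_ne_one L) w hw with he_def
  -- the subgroup-typed copy of `γ₀` (the carrier of `Gqs L v` is the subgroup type, definitionally)
  let γ₀' : ↥(unitaryGroupOfForm (conjLocal L (IsCMField.complexConj L) v) (cmLocalForm L 3 v)) := γ₀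
  have hreg' : IsRegularElt (γ₀' : GL (Fin 3) (LocalRing L v)) := hreg
  have hΩ' : (γ₀' : Gqs L v) ∉ hyperbolicSet L v := hγ₀Ω
  have hsep := (isRegularElt_iff_separable_localNonsplitEquiv L w hw γ₀).1 hreg
  -- `w`-integral traces on the one-place centraliser
  have hbd : ∀ u ∈ Subgroup.centralizer ({e γ₀} : Set ↥(unitaryGroupOfForm (galAdicCompletionMap (L := L) (IsCMField.complexConj L) hw) (placeForm (qsForm L) w.1))),
      Valued.v (Matrix.trace ((u : GL (Fin 3) (w.1.adicCompletion L)) : Matrix (Fin 3) (Fin 3) (w.1.adicCompletion L))) ≤ 1 := by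
    intro u hu
    have hu' := Subgroup.mem_centralizer_singleton_iff.1 hu
    have hcomm' := congrArg e.symm hu'
    rw [map_mul, map_mul, ContinuousMulEquiv.symm_apply_apply] at hcomm'
    have ht : (e.symm u : ↥(unitaryGroupOfForm (conjLocal L (IsCMField.complexConj L) v) (cmLocalForm L 3 v))) ∈
        Subgroup.centralizer ({γ₀'} : Set ↥(unitaryGroupOfForm (conjLocal L (IsCMField.complexConj L) v) (cmLocalForm L 3 v))) :=
      Subgroup.mem_centralizer_singleton_iff.2 hcomm'
    have h1 := v_trace_le_one_of_mem_centralizer L v hns w hreg' hΩ' ht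
    have htr : Matrix.trace ((u : GL (Fin 3) (w.1.adicCompletion L)) : Matrix (Fin 3) (Fin 3) (w.1.adicCompletion L)) =
        (Pi.evalRingHom (fun w' : PlacesOver L v => w'.1.adicCompletion L) w)
          (Matrix.trace (((e.symm u : ↥(unitaryGroupOfForm (conjLocal L (IsCMField.complexConj L) v) (cmLocalForm L 3 v))) : Gqs L v).val.val :
            Matrix (Fin 3) (Fin 3) (LocalRing L v))) := by
      conv_lhs => rw [← e.apply_symm_apply u]
      rw [Matrix.trace, Matrix.trace, map_sum]
      refine Finset.sum_congr rfl fun i _ => ?_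
      rw [Matrix.diag_apply, Matrix.diag_apply, localNonsplitEquiv_apply_apply L v w hw (e.symm u) i i, Pi.evalRingHom_apply]
    rw [htr]
    exact h1
  have hcpt := isCompact_centralizer_onePlace_of_forall_v_trace_le_one L w hw (e γ₀) hsep hbd
  -- `Z(γ₀) ⊆ e⁻¹ (Z(e γ₀))`, closed
  have hcl : IsClosed ((Subgroup.centralizer ({γ₀} : Set (Gqs L v))) : Set (Gqs L v)) := by
    have h : ((Subgroup.centralizer ({γ₀} : Set (Gqs L v))) : Set (Gqs L v)) = {g : Gqs L v | γ₀ * g = g * γ₀} := by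
      ext g
      simp [Subgroup.mem_centralizer_iff]
    rw [h]
    exact isClosed_eq (continuous_const.mul continuous_id) (continuous_id.mul continuous_const)
  refine (hcpt.image e.symm.continuous).of_isClosed_subset hcl fun t ht => ?_
  have ht' := Subgroup.mem_centralizer_singleton_iff.1 ht
  have h := congrArg e ht'
  rw [map_mul, map_mul] at h
  exact ⟨e t, Subgroup.mem_centralizer_singleton_iff.2 h, e.symm_apply_apply t⟩

/-- **Compact centraliser ⟺ not hyperbolic**, for a REGULAR `γ₀ ∈ U(Φ₃)(L⁺_v)` at a non-split `v` (§3 + ★ S9a «ELL-CARTAN-AVOIDS-Ω»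
`not_mem_hyperbolicSet_of_isCompact_centralizer`). [cite: Rogawski1990, §12.5 p. 184; §3.6 pp. 28–31] -/
theorem isCompact_centralizer_iff_not_mem_hyperbolicSet (hns : ∀ w : PlacesOver L v, IsCMField.complexConj L • w.1 = w.1) {γ₀ : Gqs L v}
    (hreg : IsRegularElt (γ₀.val : GL (Fin 3) (LocalRing L v))) :
    IsCompact ((Subgroup.centralizer ({γ₀} : Set (Gqs L v))) : Set (Gqs L v)) ↔ γ₀ ∉ hyperbolicSet L v := by
  refine ⟨fun hcpt => ?_, isCompact_centralizer_of_not_mem_hyperbolicSet L v hns hreg⟩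
  exact not_mem_hyperbolicSet_of_isCompact_centralizer L v
    (γ₀ := (γ₀ : ↥(unitaryGroupOfForm (conjLocal L (IsCMField.complexConj L) v) (cmLocalForm L 3 v)))) hreg hcpt
    (t := (γ₀ : ↥(unitaryGroupOfForm (conjLocal L (IsCMField.complexConj L) v) (cmLocalForm L 3 v)))) (Subgroup.mem_centralizer_singleton_iff.2 rfl) hreg

/-- **`G^e` IS PRINT'S SET OF REGULAR ELEMENTS WITH COMPACT CENTRALISER** (p. 184: «elliptic regular»; the centre `E¹_v` is compact, so «compact modulo the centre» = «compact»):
at any §12.5 datum on `(U(Φ₃)(L⁺_v), H)` with the field equation `hE : ellG = G^r ∖ Ω` (★ S2 COMPAT), `γ ∈ 𝔇.ellG ↔ IsRegularElt γ ∧ IsCompact Z(γ)` — print-exactness of the `ellG`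
field. [cite: Rogawski1990, §12.5 p. 184; §3.6 pp. 28–31] -/
theorem mem_ellG_iff_isRegularElt_and_isCompact_centralizer (hns : ∀ w : PlacesOver L v, IsCMField.complexConj L • w.1 = w.1)
    [MeasurableSpace (Gqs L v)]
    [∀ γ : Gqs L v, MeasurableSpace (Gqs L v ⧸ Subgroup.centralizer ({γ} : Set (Gqs L v)))] [MeasurableSpace (Gqs L v ⧸ Subgroup.center (Gqs L v))]
    {H' : Type} [Group H'] [TopologicalSpace H'] [IsTopologicalGroup H'] [MeasurableSpace H']
    (𝔇 : EllipticData (Gqs L v) H')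
    (hE : ∀ γ : Gqs L v, γ ∈ 𝔇.ellG ↔ IsRegularElt (γ.val : GL (Fin 3) (UnitaryGroup.LocalRing L v)) ∧ γ ∉ hyperbolicSet L v)
    (γ : Gqs L v) :
    γ ∈ 𝔇.ellG ↔ IsRegularElt (γ.val : GL (Fin 3) (UnitaryGroup.LocalRing L v)) ∧ IsCompact ((Subgroup.centralizer ({γ} : Set (Gqs L v))) : Set (Gqs L v)) := by
  rw [hE]
  constructor
  · rintro ⟨hreg, hΩ⟩
    exact ⟨hreg, isCompact_centralizer_of_not_mem_hyperbolicSet L v hns hreg hΩ⟩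
  · rintro ⟨hreg, hcpt⟩
    exact ⟨hreg, (isCompact_centralizer_iff_not_mem_hyperbolicSet L v hns hreg).1 hcpt⟩

set_option maxHeartbeats 800000 in  -- statement-level `whnf` on the CM carriers
/-- **A NON-COMPACT Cartan subgroup is conjugate to the split torus `M`**: if `γ₀` is regular and `Z(γ₀)` is not compact, then `γ₀ ∈ Ω`, i.e. `γ₀ = x m x⁻¹` with `m ∈ M` regular,
and `Z(γ₀) = x Z(m) x⁻¹ = x M x⁻¹` (★ `centralizer_eq_cmTorus_of_isRegularElt`): membership-wise, `g ∈ Z(γ₀) ↔ x⁻¹ g x ∈ M`.  So a finite set of representatives of the conjugacy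
classes of Cartan subgroups of `U(Φ₃)(L⁺_v)` may always be taken as `insert M (compact ones)` [§3.6: type (0) is `M`, types (1)–(3) are compact modulo the centre].
[cite: Rogawski1990, §3.6 pp. 28–31; §12.5 pp. 182, 184] -/
theorem exists_conj_cmTorus_of_not_isCompact_centralizer (hns : ∀ w : PlacesOver L v, IsCMField.complexConj L • w.1 = w.1)
    {γ₀ : ↥(unitaryGroupOfForm (conjLocal L (IsCMField.complexConj L) v) (cmLocalForm L 3 v))}
    (hreg : IsRegularElt (γ₀ : GL (Fin 3) (LocalRing L v)))
    (hnc : ¬ IsCompact ((Subgroup.centralizer ({γ₀} : Set ↥(unitaryGroupOfForm (conjLocal L (IsCMField.complexConj L) v) (cmLocalForm L 3 v)))) :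
      Set ↥(unitaryGroupOfForm (conjLocal L (IsCMField.complexConj L) v) (cmLocalForm L 3 v)))) :
    ∃ (x : ↥(unitaryGroupOfForm (conjLocal L (IsCMField.complexConj L) v) (cmLocalForm L 3 v))) (m : ↥(cmBorelTriple L 3 v).M),
      IsRegularElt (((m : ↥(unitaryGroupOfForm (conjLocal L (IsCMField.complexConj L) v) (cmLocalForm L 3 v))) : GL (Fin 3) (LocalRing L v))) ∧
      x * (m : ↥(unitaryGroupOfForm (conjLocal L (IsCMField.complexConj L) v) (cmLocalForm L 3 v))) * x⁻¹ = γ₀ ∧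
      ∀ g : ↥(unitaryGroupOfForm (conjLocal L (IsCMField.complexConj L) v) (cmLocalForm L 3 v)),
        g ∈ Subgroup.centralizer ({γ₀} : Set ↥(unitaryGroupOfForm (conjLocal L (IsCMField.complexConj L) v) (cmLocalForm L 3 v))) ↔
          x⁻¹ * g * x ∈ (cmBorelTriple L 3 v).M := by
  have hΩ : (γ₀ : Gqs L v) ∈ hyperbolicSet L v := by
    by_contra h
    exact hnc (isCompact_centralizer_of_not_mem_hyperbolicSet L v hns (γ₀ := (γ₀ : Gqs L v)) hreg h)
  obtain ⟨m, hmreg, hconj⟩ := hΩ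
  obtain ⟨x, hx⟩ := isConj_iff.1 hconj
  let x' : ↥(unitaryGroupOfForm (conjLocal L (IsCMField.complexConj L) v) (cmLocalForm L 3 v)) := x
  have hx' : x' * (m : ↥(unitaryGroupOfForm (conjLocal L (IsCMField.complexConj L) v) (cmLocalForm L 3 v))) * x'⁻¹ = γ₀ := hx
  have hZm := F0P3cStCharTSWeylHypCM.centralizer_eq_cmTorus_of_isRegularElt L v m.2 hmreg
  refine ⟨x', m, hmreg, hx', fun g => ?_⟩
  rw [← hZm, Subgroup.mem_centralizer_singleton_iff, Subgroup.mem_centralizer_singleton_iff, ← hx']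
  have h1 : x'⁻¹ * g * x' * ↑m = x'⁻¹ * (g * (x' * ↑m * x'⁻¹)) * x' := by group
  have h2 : ↑m * (x'⁻¹ * g * x') = x'⁻¹ * ((x' * ↑m * x'⁻¹) * g) * x' := by group
  rw [h1, h2]
  constructor
  · intro hg; rw [hg]
  · intro hg
    have h3 := congrArg (fun y => x' * y * x'⁻¹) hg
    have h4 : x' * (x'⁻¹ * (g * (x' * ↑m * x'⁻¹)) * x') * x'⁻¹ = g * (x' * ↑m * x'⁻¹) := by group
    have h5 : x' * (x'⁻¹ * (x' * ↑m * x'⁻¹ * g) * x') * x'⁻¹ = x' * ↑m * x'⁻¹ * g := by group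
    simp only [h4, h5] at h3
    exact h3

end Transport

end Summit.HodgeConjecture.HodgeConjecture.Cruxes.H413.F0P3cStCharTSEllCartanCompact

end
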